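import Summits.Ventures.PercRepro.S2RankThreeCount

/-!
# PercRepro — S2: THE TWO PAIR COUNTS OF THE FLAT COUNT (p7, gen 11; sub-claim S2; the flat count's (L4) and (L5))

For `W ⊆ E` and a family `𝒜` of subsets of `W`, the sets `B ⊆ E` with `B ∩ W ∈ 𝒜` and `|B ∖ W| = i`:
* **`ncard_split_le`** (L5, pure counting): `B ↦ (B ∩ W, B ∖ W)` is injective, so there are `≤ #𝒜 · C(|E ∖ W|, i)` of them;
* **`ncard_class_four_mul_le`** (L4, the `r = 4` double count): if every `X ∈ 𝒜` has rank `4` and `j` points, every rank-`≤ 5` set has `≤ f`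
  points and `cl(W) = W`, then the rank-`5` such `B` with `i ≥ 1` satisfy `#B · i ≤ #𝒜 · (|E ∖ W| · C(f − j − 1, i − 1))`: every `x ∈ B ∖ W`
  spans `cl(B) = cl(X ∪ {x})` over `X = B ∩ W` (`x ∉ cl(X) ⊆ W`), a rank-`5` flat on `≤ f` points containing `X` and `x`, so the rest
  `B ∖ W ∖ {x}` is an `(i − 1)`-subset of the `≤ f − j − 1` points of `cl(X ∪ {x}) ∖ W ∖ {x}`; the pairs `(B, x)` are counted once per
  point of `B ∖ W` (`i` times each) and at most `#𝒜 · C(f − j − 1, i − 1)` times per `x`.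
These are the two counts of proofs/P7-S2-FLATCOUNT-G11.md §2 at `d − k = 2`; with S2RankThreeCount (`N₃`) and S2FlatCase they are the
ingredients of the cells `(15, 8)` / `(15, 9)`; the assembly over `(m, j, r)` (L8) is the next item. Axioms: standard.
-/

open scoped Matroid

namespace PercRepro

namespace S2

variable {α : Type}

/-- **(L5)** `B ↦ (B ∩ W, B ∖ W)` is injective: `#{B ⊆ E : B ∩ W ∈ 𝒜, |B ∖ W| = i} ≤ #𝒜 · C(|E ∖ W|, i)`. -/
theorem ncard_split_le (M : Matroid α) [M.Finite] {W : Set α} (hW : W ⊆ M.E) (𝒜 : Set (Set α))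
    (h𝒜 : ∀ X ∈ 𝒜, X ⊆ W) (i : ℕ) :
    {B : Set α | B ⊆ M.E ∧ B ∩ W ∈ 𝒜 ∧ (B \ W).ncard = i}.ncard ≤ 𝒜.ncard * (M.E \ W).ncard.choose i := by
  classical
  have hEW : (M.E \ W).Finite := M.ground_finite.subset Set.sdiff_subset
  have hWfin : W.Finite := M.ground_finite.subset hW
  have h𝒜fin : 𝒜.Finite := hWfin.finite_subsets.subset h𝒜
  have hP : {Y : Set α | Y ⊆ M.E \ W ∧ Y.ncard = i}.ncard = (M.E \ W).ncard.choose i :=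
    ncard_subsets_ncard_eq _ hEW i
  rw [← hP, ← Set.ncard_prod]
  refine Set.ncard_le_ncard_of_injOn (fun B => (B ∩ W, B \ W)) ?_ ?_
    (h𝒜fin.prod (hEW.finite_subsets.subset (fun Y hY => hY.1)))
  · intro B hB
    obtain ⟨hBE, hBW, hBi⟩ := hB
    exact ⟨hBW, Set.sdiff_subset_sdiff_left hBE, hBi⟩
  · intro B _ C _ h
    simp only [Prod.mk.injEq] at h
    rw [← Set.inter_union_sdiff B W, ← Set.inter_union_sdiff C W, h.1, h.2]

/-- **(L4)** The `r = 4` double count: `W ⊆ E` a flat, every rank-`≤ 5` set on `≤ f` points, `𝒜` a family of rank-`4` `j`-subsets of `W`;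
the rank-`5` sets `B ⊆ E` with `B ∩ W ∈ 𝒜` and `|B ∖ W| = i ≥ 1` satisfy `#B · i ≤ #𝒜 · (|E ∖ W| · C(f − j − 1, i − 1))`. -/
theorem ncard_class_four_mul_le (M : Matroid α) [M.Finite] {W : Set α} (hW : W ⊆ M.E) (hWcl : M.closure W = W)
    (f : ℕ) (hf : ∀ F ⊆ M.E, M.eRk F ≤ 5 → F.ncard ≤ f)
    (𝒜 : Set (Set α)) (j : ℕ) (h𝒜 : ∀ X ∈ 𝒜, X ⊆ W ∧ X.ncard = j ∧ M.eRk X = 4) (i : ℕ) (hi : 1 ≤ i) :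
    {B : Set α | B ⊆ M.E ∧ B ∩ W ∈ 𝒜 ∧ (B \ W).ncard = i ∧ M.eRk B = 5}.ncard * i ≤
      𝒜.ncard * ((M.E \ W).ncard * Nat.choose (f - j - 1) (i - 1)) := by
  classical
  set 𝒞 := {B : Set α | B ⊆ M.E ∧ B ∩ W ∈ 𝒜 ∧ (B \ W).ncard = i ∧ M.eRk B = 5} with h𝒞
  have hWfin : W.Finite := M.ground_finite.subset hW
  have h𝒜fin : 𝒜.Finite := hWfin.finite_subsets.subset (fun X hX => (h𝒜 X hX).1)
  have h𝒞fin : 𝒞.Finite := M.ground_finite.finite_subsets.subset (fun B hB => hB.1)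
  have hEW : (M.E \ W).Finite := M.ground_finite.subset Set.sdiff_subset
  set s : Finset (Set α) := h𝒞fin.toFinset with hs
  set t : Finset α := hEW.toFinset with ht
  let r : Set α → α → Prop := fun B x => x ∈ B
  -- each `B` has exactly `i` points outside `W`
  have hm : ∀ B ∈ s, i ≤ (t.bipartiteAbove r B).card := by
    intro B hBs
    rw [hs, Set.Finite.mem_toFinset] at hBs
    obtain ⟨hBE, -, hBi, -⟩ := hBs
    have hset : ((t.bipartiteAbove r B : Finset α) : Set α) = B \ W := by
      ext x
      rw [Finset.coe_bipartiteAbove, Set.mem_setOf_eq, ht, Set.Finite.mem_toFinset]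
      constructor
      · rintro ⟨⟨-, hxW⟩, hxB⟩
        exact ⟨hxB, hxW⟩
      · rintro ⟨hxB, hxW⟩
        exact ⟨⟨hBE hxB, hxW⟩, hxB⟩
    rw [← hBi, ← hset, Set.ncard_coe_finset]
  -- each `x ∉ W` lies in at most `#𝒜 · C(f − j − 1, i − 1)` of the sets
  have hn : ∀ x ∈ t, (s.bipartiteBelow r x).card ≤ 𝒜.ncard * Nat.choose (f - j - 1) (i - 1) := by
    intro x hxt
    rw [ht, Set.Finite.mem_toFinset] at hxt
    obtain ⟨hxE, hxW⟩ := hxt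
    have hcover : ((s.bipartiteBelow r x : Finset (Set α)) : Set (Set α)) ⊆
        ⋃ X ∈ h𝒜fin.toFinset, {B : Set α | B ∈ 𝒞 ∧ x ∈ B ∧ B ∩ W = X} := by
      intro B hB
      rw [Finset.mem_coe, Finset.mem_bipartiteBelow] at hB
      obtain ⟨hBs, hxB⟩ := hB
      rw [hs, Set.Finite.mem_toFinset] at hBs
      rw [Set.mem_iUnion₂]
      exact ⟨B ∩ W, by rw [Set.Finite.mem_toFinset]; exact hBs.2.1, hBs, hxB, rfl⟩
    have hunion_fin : (⋃ X ∈ h𝒜fin.toFinset, {B : Set α | B ∈ 𝒞 ∧ x ∈ B ∧ B ∩ W = X}).Finite :=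
      h𝒞fin.subset (by
        intro B hB
        rw [Set.mem_iUnion₂] at hB
        obtain ⟨X, -, hB, -, -⟩ := hB
        exact hB)
    have hunion := Finset.set_ncard_biUnion_le h𝒜fin.toFinset
      (fun X => {B : Set α | B ∈ 𝒞 ∧ x ∈ B ∧ B ∩ W = X})
    have hfib : ∀ X ∈ h𝒜fin.toFinset,
        {B : Set α | B ∈ 𝒞 ∧ x ∈ B ∧ B ∩ W = X}.ncard ≤ Nat.choose (f - j - 1) (i - 1) := by
      intro X hX
      rw [Set.Finite.mem_toFinset] at hX
      obtain ⟨hXW, hXj, hX4⟩ := h𝒜 X hX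
      have hXE : X ⊆ M.E := hXW.trans hW
      have hXfin : X.Finite := hWfin.subset hXW
      have hxcl : x ∉ M.closure X := fun h => hxW (by rw [← hWcl]; exact M.closure_subset_closure hXW h)
      have hr5 : M.eRk (insert x X) = 5 := by
        rw [Matroid.eRk_insert_eq_add_one ⟨hxE, hxcl⟩, hX4]
        norm_num
      have hiXE : insert x X ⊆ M.E := Set.insert_subset hxE hXE
      set F := M.closure (insert x X) with hF
      have hFE : F ⊆ M.E := M.closure_subset_ground _
      have hF5 : M.eRk F ≤ 5 := by rw [hF, M.eRk_closure_eq, hr5]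
      have hFcard : F.ncard ≤ f := hf F hFE hF5
      have hFfin : F.Finite := M.ground_finite.subset hFE
      have hiXF : insert x X ⊆ F := M.subset_closure _ hiXE
      have hXF : X ⊆ F := (Set.subset_insert x X).trans hiXF
      have hxF : x ∈ F := hiXF (Set.mem_insert x X)
      set Z := (F \ W) \ {x} with hZ
      have hZfin : Z.Finite := hFfin.subset (Set.sdiff_subset.trans Set.sdiff_subset)
      have hZcard : Z.ncard ≤ f - j - 1 := by
        have h1 := Set.ncard_inter_add_ncard_sdiff_eq_ncard F W hFfin
        have h2 : j ≤ (F ∩ W).ncard := by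
          rw [← hXj]
          exact Set.ncard_le_ncard (Set.subset_inter hXF hXW) (hFfin.subset Set.inter_subset_left)
        have h3 : Z.ncard + 1 = (F \ W).ncard :=
          Set.ncard_sdiff_singleton_add_one ⟨hxF, hxW⟩ (hFfin.subset Set.sdiff_subset)
        omega
      calc {B : Set α | B ∈ 𝒞 ∧ x ∈ B ∧ B ∩ W = X}.ncard
          ≤ {R : Set α | R ⊆ Z ∧ R.ncard = i - 1}.ncard := by
            refine Set.ncard_le_ncard_of_injOn (fun B => (B \ W) \ {x}) ?_ ?_
              (hZfin.finite_subsets.subset (fun R hR => hR.1))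
            · intro B hB
              obtain ⟨⟨hBE, -, hBi, hB5⟩, hxB, hBX⟩ := hB
              have hBfin : B.Finite := M.ground_finite.subset hBE
              have hsub : insert x X ⊆ B := Set.insert_subset hxB (by rw [← hBX]; exact Set.inter_subset_left)
              have hrk : M.IsRkFinite (insert x X) := M.isRkFinite_of_finite (hXfin.insert x)
              have hcl : M.closure (insert x X) = M.closure B :=
                hrk.closure_eq_closure_of_subset_of_eRk_ge_eRk hsub (by rw [hB5, hr5])
              have hBF : B ⊆ F := by
                rw [hF, hcl]
                exact M.subset_closure B hBE
              refine ⟨?_, ?_⟩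
              · intro y hy
                exact ⟨⟨hBF hy.1.1, hy.1.2⟩, hy.2⟩
              · have h4 : ((B \ W) \ {x}).ncard + 1 = (B \ W).ncard :=
                  Set.ncard_sdiff_singleton_add_one ⟨hxB, hxW⟩ (hBfin.subset Set.sdiff_subset)
                omega
            · intro B hB C hC hBC
              obtain ⟨⟨-, -, -, -⟩, hxB, hBX⟩ := hB
              obtain ⟨⟨-, -, -, -⟩, hxC, hCX⟩ := hC
              simp only at hBC
              have hB' : B = X ∪ insert x ((B \ W) \ {x}) := by
                rw [Set.insert_sdiff_singleton, Set.insert_eq_of_mem (show x ∈ B \ W from ⟨hxB, hxW⟩), ← hBX, Set.inter_union_sdiff]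
              have hC' : C = X ∪ insert x ((C \ W) \ {x}) := by
                rw [Set.insert_sdiff_singleton, Set.insert_eq_of_mem (show x ∈ C \ W from ⟨hxC, hxW⟩), ← hCX, Set.inter_union_sdiff]
              rw [hB', hC', hBC]
          _ = Z.ncard.choose (i - 1) := ncard_subsets_ncard_eq Z hZfin (i - 1)
          _ ≤ Nat.choose (f - j - 1) (i - 1) := Nat.choose_le_choose _ hZcard
    calc (s.bipartiteBelow r x).card
        = ((s.bipartiteBelow r x : Finset (Set α)) : Set (Set α)).ncard := (Set.ncard_coe_finset _).symm
      _ ≤ (⋃ X ∈ h𝒜fin.toFinset, {B : Set α | B ∈ 𝒞 ∧ x ∈ B ∧ B ∩ W = X}).ncard :=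
          Set.ncard_le_ncard hcover hunion_fin
      _ ≤ ∑ X ∈ h𝒜fin.toFinset, {B : Set α | B ∈ 𝒞 ∧ x ∈ B ∧ B ∩ W = X}.ncard := hunion
      _ ≤ h𝒜fin.toFinset.card • Nat.choose (f - j - 1) (i - 1) := Finset.sum_le_card_nsmul _ _ _ hfib
      _ = 𝒜.ncard * Nat.choose (f - j - 1) (i - 1) := by
          rw [smul_eq_mul, Set.ncard_eq_toFinset_card _ h𝒜fin]
  have hdc := Finset.card_mul_le_card_mul r hm hn
  have hs_card : s.card = 𝒞.ncard := by rw [hs, Set.ncard_eq_toFinset_card _ h𝒞fin]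
  have ht_card : t.card = (M.E \ W).ncard := by rw [ht, Set.ncard_eq_toFinset_card _ hEW]
  rw [hs_card, ht_card] at hdc
  calc 𝒞.ncard * i ≤ (M.E \ W).ncard * (𝒜.ncard * Nat.choose (f - j - 1) (i - 1)) := hdc
    _ = 𝒜.ncard * ((M.E \ W).ncard * Nat.choose (f - j - 1) (i - 1)) := by ring

end S2

end PercRepro
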